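import Summits.BirchSwinnertonDyer.BirchSwinnertonDyer.Theorems.KimAtThreeD7uUnramifiedMembershipCyclotomic
import Summits.BirchSwinnertonDyer.Rank1Residual.X11b.MaxUnramifiedRestriction
import HarnessLib

/-!
# D7-u in the tree's NAMED currency, every `p`: Kolyvagin's derivative class of an Euler system of
# `T_pE` unramified above `w ∤ p`, `w ∉ r`, satisfies at `w` the BLOCH–KATO local condition
# `H¹_f(ℚ_w, E[p^k·p]) := π_{k+1,*} H¹_ur(ℚ_w, T_pE)` of the datum `π_{k+1} : T_pE → E[p^k·p]`
# — [MR04] Remark A.5's `𝓕_u`, i.e. `blochKatoSelmerStructure p (tateTorsionDatum W p k) L (Sum.inr w)`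
# (cell `bsd-addord`, seat w2-tamdiv gen 2; route W2 `KimAtThreeKolyvagin`, crux 19560 (C3) / TamDiv∞)

HONEST FRAMING: TOOL theorems (no definition, no named fact, no `sorry`); closes nothing by itself;
nothing is booked; BSD is not proved by any of this.  The companion files
`KimAtThreeD7uUnramifiedMembership{,Cyclotomic}` give the `𝓕_u` END in bare form
(`∃ y ∈ H¹(ℚ_w, T_pE)`, `res_{I_w} y = 0`, `π_{k+1,*} y = loc_w (Φ κ)`); this file identifies that
bare form with membership in the tree's existing NAMED local condition — Mazur–Rubin's unramified
structure `𝓕_u` propagated from `T_pE` ([MR04] Prop. 6.2.6 / Remark A.5) IS Bloch–Kato's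
`finiteSubgroup` of the datum `tateTorsionDatum W p k` at `w ∤ p`
(`BlochKatoDatum.finiteSubgroup = π_* (unramifiedSubgroup)`, `BlochKatoSelmerGroup.lean`), the local
condition of `blochKatoSelmerStructure p (tateTorsionDatum W p k) L` away from `p` — so that
«Kato's Kolyvagin classes form a Kolyvagin system for `𝓕_u`» can be CONSUMED in Selmer-structure
currency (the Kolyvagin-system form of «TamDiv∞», Büyükboduk 2009 Thm. 3.1, [MR04] Prop. 6.2.6).

## What

* §1 (local, any `p`, finite `w`): `mem_unramifiedSubgroup_iff_resSubgroup_absInertia_eq_zero` —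
  for `y ∈ H¹(ℚ_w, T_pE)`: `y ∈ unramifiedSubgroup` (kernel of the restriction to `Γ_{ℚ_w^{nr}}`,
  the tree's definition) iff `res_{I_w} y = 0` (restriction to the SUBGROUP `absInertia ℚ_w`): the
  range of `Γ_{ℚ_w^{nr}} → Γ_{ℚ_w}` is `I_w` (X11b `LocBridge.range_absGaloisRestrict_maxUnramified`) and
  the kernel of a pull-back on `H¹` depends only on the range (`LocBridge.map_oneCocycleClass_eq_zero_iff`);
  `mem_finiteSubgroup_tate_iff` — `x ∈ H¹_f(ℚ_w, E[p^k·p])` (Bloch–Kato, datum `π_{k+1}`) iff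
  `x = π_{k+1,*} y` for some `y` with `res_{I_w} y = 0`.
* §2 (any `p`): **`localization_mem_blochKatoSelmerStructure_of_unramified`** — under the binders of
  `KimAtThreeD7uUnramifiedMembership.exists_unramified_tateLocalMap_eq_localization_of_unramified` and
  `p ∉ w`: `loc_w (Φ κ) ∈ blochKatoSelmerStructure p (tateTorsionDatum W p k) L (Sum.inr w)` for EVERY
  choice `L` of conditions above `p`; **`…_of_res_eq_deriv_of_unramified`** — the same on Kato's
  cyclotomic levels `cyclotomicLevelsRat p S`.

References: B. Mazur, K. Rubin, *Kolyvagin systems*, Mem. AMS 799 (2004), Prop. 6.2.6 (p. 75), App. A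
Remark A.5 (p. 81); S. Bloch, K. Kato, *L-functions and Tamagawa numbers of motives* (1990), (3.7.1),
Def. 5.1; K. Rubin, *Euler Systems* (2000), Lemma 1.3.2, 1.3.5; K. Büyükboduk, JNT 129 (2009) Thm. 3.1;
J. S. Milne, *Arithmetic Duality Theorems*, I §2.
-/

noncomputable section

-- the cell's Theorems namespace `Summit.BirchSwinnertonDyer.BirchSwinnertonDyer.…` repeats the summit name by design (D-0017)
set_option linter.dupNamespace false

open CategoryTheory Function Finset Polynomial Field IsDedekindDomain NumberField
open scoped NumberField Classical
open Literature.NumberTheory.GaloisRepresentations Literature.NumberTheory.EllipticCurves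
open Literature.NumberTheory.GaloisRepresentations.IsNonarchimedeanLocalField
open WeierstrassCurve
open Summit.BirchSwinnertonDyer.Rank1Residual.GaloisImage
open Summit.BirchSwinnertonDyer.Rank1Residual.GaloisImage.CyclotomicLevel
open Summit.BirchSwinnertonDyer.Rank1Residual.GaloisImage.Derivative
open Summit.BirchSwinnertonDyer.Rank1Residual.GaloisImage.Derivative.Transverse.Rat
open Summit.BirchSwinnertonDyer.Rank1Residual.X11b
open Summit.BirchSwinnertonDyer.BirchSwinnertonDyer.Theorems.KimAtThreeD7uUnramifiedMembership
open Summit.BirchSwinnertonDyer.BirchSwinnertonDyer.Theorems.KimAtThreeD7uUnramifiedMembershipCyclotomic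
open Rat.HeightOneSpectrum

universe w

namespace Summit.BirchSwinnertonDyer.BirchSwinnertonDyer.Theorems.KimAtThreeD7uBlochKatoCondition

/-! ### §1 `H¹_ur(ℚ_w, T_pE)` as `ker res_{I_w}`; Bloch–Kato's `H¹_f(ℚ_w, E[p^k·p])` as `π_* ker res_{I_w}` -/

section Local

variable (W : WeierstrassCurve ℚ) [W.IsElliptic] (p : ℕ) [hp : Fact p.Prime] (k : ℕ)
  (w : HeightOneSpectrum (𝓞 ℚ))

/-- Local notation: `T_pE|_{Γ_{ℚ_w}}` (= `tateLocalRep W p (Sum.inr w)` =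
`((tateTorsionDatum W p k).toLocal w).repV`, by `rfl`). -/
local notation3 "𝕋" => (GaloisRep.restrictField (HeightOneSpectrum.adicCompletion ℚ w)
  (WeierstrassCurve.tateGaloisRep W p (W.continuous_galoisRepTate_holds p)).toIntRep)

omit [W.IsElliptic] in
/-- **`H¹_ur(ℚ_w, T_pE) = ker (res : H¹(ℚ_w, T_pE) → H¹(I_w, T_pE))`**: a class `y` of `T_pE|_{Γ_{ℚ_w}}`
lies in the tree's `unramifiedSubgroup` (kernel of the pull-back to `Γ_{ℚ_w^{nr}}`) iff its restriction
to the inertia SUBGROUP `absInertia ℚ_w` vanishes (the pull-back's kernel depends only on its range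
`I_w`). [cite: MilneADT2006, Ch. I §2 (unramified cohomology)] -/
theorem mem_unramifiedSubgroup_iff_resSubgroup_absInertia_eq_zero (y : (𝕋).cohomology 1) :
    y ∈ GaloisRep.unramifiedSubgroup (𝕋) 1 ↔
      resSubgroup (𝕋).toTopRep (absInertia (w.adicCompletion ℚ)) 1 y = 0 := by
  set F := w.adicCompletion ℚ with hFdef
  obtain ⟨z, rfl⟩ := oneCocycleClass_surjective _ y
  refine (GaloisRep.mem_unramifiedSubgroup_iff _ 1 _).trans ?_
  refine (LocBridge.map_oneCocycleClass_eq_zero_iff (𝕋).toTopRep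
    ((𝕋).restrict (absGaloisRestrict F (maxUnramified F))).toTopRep
    (absGaloisRestrict F (maxUnramified F)) (TopRep.ofHom ⟨ContinuousLinearMap.id ℤ _, fun _ => rfl⟩)
    Function.bijective_id z).trans ?_
  rw [resSubgroup_oneCocycleClass, oneCocycleClass_eq_zero_iff]
  constructor
  · rintro ⟨v, hv⟩
    refine ⟨v, fun n => ?_⟩
    obtain ⟨l, hl⟩ : (n : absoluteGaloisGroup F) ∈ Set.range (absGaloisRestrict F (maxUnramified F)) := by
      rw [LocBridge.setRange_absGaloisRestrict_maxUnramified F]; exact n.2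
    rw [resSubgroup_pullback_apply, subgroupRep_ρ_apply, ← hl]
    exact hv l
  · rintro ⟨v, hv⟩
    refine ⟨v, fun l => ?_⟩
    have hl : absGaloisRestrict F (maxUnramified F) l ∈ absInertia F := by
      rw [← SetLike.mem_coe, ← LocBridge.setRange_absGaloisRestrict_maxUnramified F]
      exact Set.mem_range_self l
    have h := hv ⟨_, hl⟩
    rw [resSubgroup_pullback_apply, subgroupRep_ρ_apply] at h
    exact h

/-- **Bloch–Kato's `H¹_f(ℚ_w, E[p^k·p]) = π_{k+1,*} ker res_{I_w}`**: a class `x` of `E[p^k·p]|_{Γ_{ℚ_w}}`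
lies in the `finiteSubgroup` of the local datum `(tateTorsionDatum W p k).toLocal w`
(`= π_* H¹_ur(ℚ_w, T_pE)`, [MR04]'s `𝓕_u` at `w`) iff `x = π_{k+1,*} y` for some `y ∈ H¹(ℚ_w, T_pE)` with
`res_{I_w} y = 0` — the conclusion shape of `KimAtThreeD7uUnramifiedMembership`.
[cite: BlochKato1990, (3.7.1)] [cite: MazurRubin2004, App. A Remark A.5 (p. 81)] -/
theorem mem_finiteSubgroup_tate_iff
    (x : galoisCohomology ((W.torsionGaloisModule ((p : ℤ) ^ k * (p : ℤ))).toLocal (Sum.inr w)) 1) :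
    x ∈ ((tateTorsionDatum W p k).toLocal w).finiteSubgroup ↔
      ∃ y : (tateLocalRep W p (Sum.inr w)).cohomology 1,
        resSubgroup (tateLocalRep W p (Sum.inr w)).toTopRep (absInertia (w.adicCompletion ℚ)) 1 y = 0 ∧
          tateLocalMap W p k (Sum.inr w) y = x := by
  refine (BlochKatoDatum.mem_finiteSubgroup_iff ((tateTorsionDatum W p k).toLocal w) x).trans ?_
  constructor
  · rintro ⟨y, hy, rfl⟩
    exact ⟨y, (mem_unramifiedSubgroup_iff_resSubgroup_absInertia_eq_zero W p w y).mp hy, rfl⟩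
  · rintro ⟨y, hy, rfl⟩
    exact ⟨y, (mem_unramifiedSubgroup_iff_resSubgroup_absInertia_eq_zero W p w y).mpr hy, rfl⟩

/-- At a finite place `w ∤ p` the Bloch–Kato structure of the datum `π_{k+1} : T_pE → E[p^k·p]` is the
`finiteSubgroup` (restatement of `blochKatoSelmerStructure_inr_of_not_mem` in this file's shape): a class
of the form `π_{k+1,*} y`, `res_{I_w} y = 0`, lies in `blochKatoSelmerStructure p (tateTorsionDatum W p k) L (Sum.inr w)`
for every `L`. [cite: BlochKato1990, Def. 5.1] [cite: MazurRubin2004, App. A Remark A.5 (p. 81)] -/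
theorem mem_blochKatoSelmerStructure_of_exists_tateLocalMap_eq
    (L : (tateTorsionDatum W p k).LocalConditionsAbove p) (hw : ((p : ℕ) : 𝓞 ℚ) ∉ w.asIdeal)
    {x : galoisCohomology ((W.torsionGaloisModule ((p : ℤ) ^ k * (p : ℤ))).toLocal (Sum.inr w)) 1}
    (hx : ∃ y : (tateLocalRep W p (Sum.inr w)).cohomology 1,
      resSubgroup (tateLocalRep W p (Sum.inr w)).toTopRep (absInertia (w.adicCompletion ℚ)) 1 y = 0 ∧
        tateLocalMap W p k (Sum.inr w) y = x) :
    x ∈ blochKatoSelmerStructure p (tateTorsionDatum W p k) L (Sum.inr w) := by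
  rw [blochKatoSelmerStructure_inr_of_not_mem _ L hw]
  exact (mem_finiteSubgroup_tate_iff W p k w x).mpr hx

/-- `𝓕_u(w) ≤ 𝓕_can(w)` in named currency: the Bloch–Kato condition of the datum `π_{k+1}` at `w ∤ p`
lies in Mazur–Rubin's propagated canonical condition `propagatedSelmerStructure W p k (Sum.inr w)`.
[cite: MazurRubin2004, App. A Remark A.5 (p. 81)] [cite: Rubin2000, Lemma 1.3.5] -/
theorem blochKatoSelmerStructure_inr_le_propagatedSelmerStructure
    (L : (tateTorsionDatum W p k).LocalConditionsAbove p) (hw : ((p : ℕ) : 𝓞 ℚ) ∉ w.asIdeal) :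
    blochKatoSelmerStructure p (tateTorsionDatum W p k) L (Sum.inr w) ≤
      propagatedSelmerStructure W p k (Sum.inr w) := by
  intro x hx
  rw [blochKatoSelmerStructure_inr_of_not_mem _ L hw] at hx
  exact mem_propagatedSelmerStructure_of_exists_tateLocalMap_eq W p k w
    ((mem_finiteSubgroup_tate_iff W p k w x).mp hx)

end Local

/-! ### §2 The END in Bloch–Kato currency (any `p`) -/

section Global

variable (W : WeierstrassCurve ℚ) [W.IsElliptic] (p : ℕ) [Fact p.Prime]
variable [Module.Free ℤ_[p] (W.tateModule p)] [Module.Finite ℤ_[p] (W.tateModule p)]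
  [ContinuousSMul ℤ_[p] (W.tateModule p)]

/-- Local notation: `T∞ = T_p E` as a continuous `Γ_ℚ`-representation. -/
local notation3 "T∞" => WeierstrassCurve.tateGaloisRep W p (W.continuous_galoisRepTate_holds p)

/-- **[MR04] Remark A.5 at a place `w ∤ p`, named currency, every `p`**: under the binders of
`KimAtThreeD7uUnramifiedMembership.exists_unramified_tateLocalMap_eq_localization_of_unramified`
(an Euler system `c` of `T_pE` over levels `L`, THEOREM A's bottom-layer data, `T′` pinned to
`E[p^k·p]`, `Φ`, Kolyvagin's class `κ`, `w` unramified in `U_r` with every `c_{⊥,s}`, `s ⊆ r`,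
unramified above `w`) and `p ∉ w`: **`loc_w (Φ κ)` lies in the Bloch–Kato local condition
`blochKatoSelmerStructure p (tateTorsionDatum W p k) Lp (Sum.inr w) = π_{k+1,*} H¹_ur(ℚ_w, T_pE)`**, for
every choice `Lp` of conditions above `p`.
[cite: MazurRubin2004, Def. 3.2.1, Thm. 3.2.4, Prop. 6.2.6 and App. A Remark A.5 (p. 81)]
[cite: BlochKato1990, Def. 5.1] [cite: Rubin2000, Lemma 4.4.2 and Thm. 4.5.1] -/
theorem localization_mem_blochKatoSelmerStructure_of_unramified
    {ι : Type w} [Preorder ι] [OrderBot ι] {L : EulerSystemLevels ℚ ι}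
    {c : ∀ (i : ι) (r : L.Ideals), H1 T∞ (L.level i r.1)} (hc : IsEulerSystem L T∞ p c)
    {M' : Type} [AddCommGroup M'] [Module ℤ_[p] M'] [TopologicalSpace M'] [IsTopologicalAddGroup M']
    [ContinuousSMul ℤ_[p] M'] {T' : GaloisRep ℚ ℤ_[p] M'}
    (red : (T∞).toTopRep ⟶ T'.toTopRep) (k : ℕ) (Lp : (tateTorsionDatum W p k).LocalConditionsAbove p)
    (e : M' →+ geomTorsion W (((p : ℕ) : ℤ) ^ k * ((p : ℕ) : ℤ))) (hec : Continuous e)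
    (he : ∀ (g : absoluteGaloisGroup ℚ) (x : M'),
      e (T' g x) = W.torsionGaloisModule (((p : ℕ) : ℤ) ^ k * ((p : ℕ) : ℤ)) g (e x))
    (hcomp : ∀ a : W.tateModule p, tateToTorsion W p k a = e (red.hom a))
    (Φ : continuousCohomology 1 T'.toTopRep →+
      galoisCohomology (W.torsionGaloisModule (((p : ℕ) : ℤ) ^ k * ((p : ℕ) : ℤ))) 1)
    (hΦ : ∀ (φ : contOneCocycles T'.toTopRep)
      (ψ : contOneCocycles (W.torsionGaloisModule (((p : ℕ) : ℤ) ^ k * ((p : ℕ) : ℤ))).toTopRep),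
      (∀ g, ψ.1 g = e (φ.1 g)) → Φ (oneCocycleClass _ φ) = oneCocycleClass _ ψ)
    (r : L.Ideals)
    (σ : HeightOneSpectrum (𝓞 ℚ) → absoluteGaloisGroup ℚ) (N : HeightOneSpectrum (𝓞 ℚ) → ℕ)
    (Fr : HeightOneSpectrum (𝓞 ℚ) → absoluteGaloisGroup ℚ)
    (hσ : ∀ ℓ ∈ r.1, ∀ q ∈ r.1, q ≠ ℓ → σ ℓ ∈ L.tameLevel q)
    (hcov : ∀ ℓ ∈ r.1, ∀ g : absoluteGaloisGroup ℚ, ∃ j < N ℓ, (σ ℓ ^ j)⁻¹ * g ∈ L.tameLevel ℓ)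
    (hinj : ∀ ℓ ∈ r.1, ∀ j₁ < N ℓ, ∀ j₂ < N ℓ, (σ ℓ ^ j₁)⁻¹ * σ ℓ ^ j₂ ∈ L.tameLevel ℓ → j₁ = j₂)
    (hFr : ∀ ℓ ∈ r.1, IsArithFrobAtPlace ℚ ℓ (Fr ℓ))
    (hram : ∀ ℓ ∈ r.1, ∀ s ⊆ r.1, ℓ ∉ s → ¬ SubgroupIsUnramifiedAt ℚ (L.level ⊥ (insert ℓ s)) ℓ)
    (hM₁ : ∀ ℓ ∈ r.1, ∀ v : M', (N ℓ : ℤ_[p]) • v = 0)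
    (hM₂ : ∀ ℓ ∈ r.1, ∀ v : M',
      (rubinEulerFactor (T∞).toRepresentation (cyclotomicCharacterToUnits ℚ p ℤ_[p]) (Fr ℓ)).eval 1 •
        v = 0)
    (comm)
    (h0 : ∀ v : T'.toTopRep, (∀ u : L.level ⊥ r.1, T'.toTopRep.ρ (u : absoluteGaloisGroup ℚ) v = v) →
      v = 0)
    (κ : continuousCohomology 1 T'.toTopRep)
    (hκ : resSubgroup T'.toTopRep (L.level ⊥ r.1) 1 κ =
        (r.1.noncommProd (fun ℓ => ∑ j ∈ range (N ℓ), (j : Module.End ℤ_[p] (continuousCohomology 1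
          (subgroupRep T'.toTopRep (L.level ⊥ r.1)))) *
          (conjMap T'.toTopRep (L.level ⊥ r.1) (σ ℓ) 1).hom.toLinearMap ^ j) comm)
        (ContinuousCohomology.map (ContinuousMonoidHom.id _) (X := subgroupRep (T∞).toTopRep (L.level ⊥ r.1))
          (Y := subgroupRep T'.toTopRep (L.level ⊥ r.1))
          ((TopRep.resFunctor (L.level ⊥ r.1).subtype).map red) 1 (c ⊥ r)))
    (w : HeightOneSpectrum (𝓞 ℚ)) (hpw : ((p : ℕ) : 𝓞 ℚ) ∉ w.asIdeal)
    (hwU : SubgroupIsUnramifiedAt ℚ (L.level ⊥ r.1) w)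
    (hur : ∀ (s : Finset (HeightOneSpectrum (𝓞 ℚ))) (hs : s ⊆ r.1)
      (𝔓 : Ideal (absIntegers (𝓞 ℚ) ℚ)) (h𝔓 : 𝔓 ∈ w.primesAbove),
      resLe (T∞).toTopRep (hwU 𝔓 h𝔓) 1
        (resLe (T∞).toTopRep (level_antitone L ⊥ hs) 1 (c ⊥ ⟨s, fun q hq => r.2 q (hs hq)⟩)) = 0) :
    galoisCohomology.localization (W.torsionGaloisModule (((p : ℕ) : ℤ) ^ k * ((p : ℕ) : ℤ)))
        (Sum.inr w) 1 (Φ κ) ∈ blochKatoSelmerStructure p (tateTorsionDatum W p k) Lp (Sum.inr w) :=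
  mem_blochKatoSelmerStructure_of_exists_tateLocalMap_eq W p k w Lp hpw
    (exists_unramified_tateLocalMap_eq_localization_of_unramified W p hc red k e hec he hcomp Φ hΦ r σ N Fr
      hσ hcov hinj hFr hram hM₁ hM₂ comm h0 κ hκ w hwU hur)

variable {S : Set (HeightOneSpectrum (𝓞 ℚ))}

/-- Local notation: `𝓛` = Kato's cyclotomic levels `ℚ(μ_{p^{n+1}}, μ_r)`, `r ∩ S = ∅`. -/
local notation3 "𝓛" => cyclotomicLevelsRat p S

/-- **[MR04] Remark A.5 on Kato's cyclotomic levels, named currency, every `p`**: under the binders of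
`KimAtThreeD7uUnramifiedMembershipCyclotomic.exists_unramified_tateLocalMap_eq_localization_of_res_eq_deriv_of_unramified`
(`w ∉ r`, `hur` = (C2) of `ZetaBody` at the sub-levels) and `p ∉ w`:
`loc_w (Φ κ) ∈ blochKatoSelmerStructure p (tateTorsionDatum W p k) Lp (Sum.inr w)` for every `Lp`.
[cite: MazurRubin2004, Def. 3.2.1, Thm. 3.2.4, Prop. 6.2.6 and App. A Remark A.5 (p. 81)]
[cite: BlochKato1990, Def. 5.1] [cite: Kato2004Asterisque, (8.1.3) (p. 180) and Lemma 8.5] -/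
theorem localization_mem_blochKatoSelmerStructure_of_res_eq_deriv_of_unramified (k : ℕ)
    (Lp : (tateTorsionDatum W p k).LocalConditionsAbove p)
    {M' : Type} [AddCommGroup M'] [Module ℤ_[p] M'] [TopologicalSpace M']
    [IsTopologicalAddGroup M'] [ContinuousSMul ℤ_[p] M'] {T' : GaloisRep ℚ ℤ_[p] M'}
    {c : ∀ (i : ℕ) (r : (𝓛).Ideals), H1 T∞ ((𝓛).level i r.1)} (hc : IsEulerSystem 𝓛 T∞ p c)
    (red : (T∞).toTopRep ⟶ T'.toTopRep)
    (e : M' →+ WeierstrassCurve.geomTorsion W (((p : ℕ) : ℤ) ^ k * ((p : ℕ) : ℤ))) (hec : Continuous e)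
    (he : ∀ (g : absoluteGaloisGroup ℚ) (x : M'),
      e (T' g x) = W.torsionGaloisModule (((p : ℕ) : ℤ) ^ k * ((p : ℕ) : ℤ)) g (e x))
    (hcomp : ∀ a : W.tateModule p, tateToTorsion W p k a = e (red.hom a))
    (Φ : continuousCohomology 1 T'.toTopRep →+
      galoisCohomology (W.torsionGaloisModule (((p : ℕ) : ℤ) ^ k * ((p : ℕ) : ℤ))) 1)
    (hΦ : ∀ (φ : contOneCocycles T'.toTopRep)
      (ψ : contOneCocycles (W.torsionGaloisModule (((p : ℕ) : ℤ) ^ k * ((p : ℕ) : ℤ))).toTopRep),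
      (∀ g, ψ.1 g = e (φ.1 g)) → Φ (oneCocycleClass _ φ) = oneCocycleClass _ ψ)
    (r : (𝓛).Ideals) (σ : HeightOneSpectrum (𝓞 ℚ) → absoluteGaloisGroup ℚ)
    (Fr : HeightOneSpectrum (𝓞 ℚ) → absoluteGaloisGroup ℚ)
    (hσ : ∀ ℓ ∈ r.1, ∀ q ∈ r.1, q ≠ ℓ → σ ℓ ∈ (𝓛).tameLevel q)
    (hcov : ∀ ℓ ∈ r.1, ∀ g : absoluteGaloisGroup ℚ,
      ∃ j < ((primesEquiv ℓ : Nat.Primes) : ℕ) - 1, (σ ℓ ^ j)⁻¹ * g ∈ (𝓛).tameLevel ℓ)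
    (hinj : ∀ ℓ ∈ r.1, ∀ j₁ < ((primesEquiv ℓ : Nat.Primes) : ℕ) - 1,
      ∀ j₂ < ((primesEquiv ℓ : Nat.Primes) : ℕ) - 1, (σ ℓ ^ j₁)⁻¹ * σ ℓ ^ j₂ ∈ (𝓛).tameLevel ℓ → j₁ = j₂)
    (hFr : ∀ ℓ ∈ r.1, IsArithFrobAtPlace ℚ ℓ (Fr ℓ))
    (hram : ∀ ℓ ∈ r.1, ∀ s ⊆ r.1, ℓ ∉ s → ¬ SubgroupIsUnramifiedAt ℚ ((𝓛).level ⊥ (insert ℓ s)) ℓ)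
    (hM₁ : ∀ ℓ ∈ r.1, ∀ v : M', ((((primesEquiv ℓ : Nat.Primes) : ℕ) - 1 : ℕ) : ℤ_[p]) • v = 0)
    (hM₂ : ∀ ℓ ∈ r.1, ∀ v : M',
      (rubinEulerFactor (T∞).toRepresentation (cyclotomicCharacterToUnits ℚ p ℤ_[p]) (Fr ℓ)).eval 1 •
        v = 0)
    (comm)
    (h0 : ∀ v : T'.toTopRep,
      (∀ u : (𝓛).level ⊥ r.1, T'.toTopRep.ρ (u : absoluteGaloisGroup ℚ) v = v) → v = 0)
    (κ : continuousCohomology 1 T'.toTopRep)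
    (hκ : resSubgroup T'.toTopRep ((𝓛).level ⊥ r.1) 1 κ =
        (r.1.noncommProd (fun ℓ => ∑ j ∈ range (((primesEquiv ℓ : Nat.Primes) : ℕ) - 1),
          (j : Module.End ℤ_[p] (continuousCohomology 1 (subgroupRep T'.toTopRep ((𝓛).level ⊥ r.1)))) *
          (conjMap T'.toTopRep ((𝓛).level ⊥ r.1) (σ ℓ) 1).hom.toLinearMap ^ j) comm)
        (ContinuousCohomology.map (ContinuousMonoidHom.id _)
          (X := subgroupRep (T∞).toTopRep ((𝓛).level ⊥ r.1))
          (Y := subgroupRep T'.toTopRep ((𝓛).level ⊥ r.1))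
          ((TopRep.resFunctor ((𝓛).level ⊥ r.1).subtype).map red) 1 (c ⊥ r)))
    (w : HeightOneSpectrum (𝓞 ℚ)) (hpw : ((p : ℕ) : 𝓞 ℚ) ∉ w.asIdeal) (hw : w ∉ r.1)
    (hur : ∀ (s : Finset (HeightOneSpectrum (𝓞 ℚ))) (hs : s ⊆ r.1)
      (𝔓 : Ideal (absIntegers (𝓞 ℚ) ℚ)), 𝔓 ∈ w.primesAbove →
      resLe (T∞).toTopRep
        (inf_le_left : (𝓛).level ⊥ s ⊓ 𝔓.inertia (absoluteGaloisGroup ℚ) ≤ (𝓛).level ⊥ s) 1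
        (c ⊥ ⟨s, fun q hq => r.2 q (hs hq)⟩) = 0) :
    galoisCohomology.localization (W.torsionGaloisModule (((p : ℕ) : ℤ) ^ k * ((p : ℕ) : ℤ))) (Sum.inr w) 1
        (Φ κ) ∈ blochKatoSelmerStructure p (tateTorsionDatum W p k) Lp (Sum.inr w) :=
  mem_blochKatoSelmerStructure_of_exists_tateLocalMap_eq W p k w Lp hpw
    (exists_unramified_tateLocalMap_eq_localization_of_res_eq_deriv_of_unramified W p k hc red e hec he hcomp
      Φ hΦ r σ Fr hσ hcov hinj hFr hram hM₁ hM₂ comm h0 κ hκ w hw hur)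

end Global

end Summit.BirchSwinnertonDyer.BirchSwinnertonDyer.Theorems.KimAtThreeD7uBlochKatoCondition

end
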